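import Summits.BirchSwinnertonDyer.BirchSwinnertonDyer.Theorems.CyclotomicUntwistPSIrrIffSurjThree
import Summits.BirchSwinnertonDyer.Rank1Residual.WAll.TargetAdditiveAtThreePotSSImage
import HarnessLib

/-!
# LAW L-irr3, global reading: an IRREDUCIBLE but NOT SURJECTIVE mod-`3` representation of `E/ℚ` forces
# `Δ_min ∈ (ℚ₃ˣ)³` — and the W-ALL block-A atom «irreducible, not onto, rank one» at `3` lives on the
# `3`-adic cube class

Cell `pub/bsd-wall` (D-0145 line `route-BirchSwinnertonDyer-CyclotomicUntwist`), seat `bsd-line-cycu-p4`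
(width seat 4, gen 6). Helper toward the cruxes K1 `PSRankOneLowerHalfAtThree` (stmt-BirchSwinnertonDyer-21580)
and K2 `PSRankOneUpperHalfAtThree` (stmt-21581). THEOREMS ONLY (no definition, no named fact, no
`sorry`); route-free; BSD is not proved by this file, no crux and no W-ALL atom is closed by it. Fifth file
of LAW L-irr3 (`…PSIrrIffSurjThree.surj_three_iff_irr_of_not_cubeClass`).

* **`cubeClass_of_irr_of_not_surj`** — for EVERY globally minimal elliptic `W/ℚ`: `E[3]` irreducible and
  `ρ̄_{E,3}` not onto ⟹ `3 ∣ v₃(Δ_min)` and `Δ_min/3^v ≡ ±1 (mod 9)`, i.e. `Δ_min` is a `3`-adic cube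
  (contrapositive of `surj_three_iff_irr_of_not_cubeClass`: off the cube class `E[3]|G_{ℚ₃}` has exactly one
  stable line, p2's `numStableLinesAtThree_eq_one_of_not_cubeClass`, and then `Irr ⇒ Surj`). Classically:
  `ℚ(E[3]) ⊇ ℚ(∛Δ)` and a proper irreducible image with surjective determinant has order prime to `3`
  (Serre §5.3, Prop. 15); the tree's proof is the LOCAL one (non-split line at `3`).
* `numStableLinesAtThree_ne_one_of_irr_of_not_surj` — the same in V10 currency (`E[3]|G_{ℚ₃}` is IRR or
  SPLIT, never one line).
* W-ALL block A (rank one, potentially supersingular additive `3`) by image, file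
  `WAll/TargetAdditiveAtThreePotSSImage.lean`: **`wAllExclAddPotSSAtThreeRankOneIrrNotSurj_iff_cubeClass`** —
  the atom A3 «`Irr W 3 ∧ ¬ Surj W 3`» (tame `ClassO5` ∪ wild `ClassO6`; dossier: `551` classes, `498` at
  `r = 1`) is equivalent to its restriction to the rows with `Δ_min` a `3`-adic cube; likewise the tame atom
  (`wAllExclAddTameSSAtThreeRankOneIrrNotSurj_iff_cubeClass`). With file 4 (wild atom ⟺ the two
  tame-torsion cells) this types WHERE sub-block A3 can live, by theorem rather than by census.

References: J.-P. Serre, Invent. Math. 15 (1972) §2.4 Prop. 15, §5.3 [Serre1972]; A. Kraus, Manuscripta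
Math. 69 (1990) [Kraus1990]; cell dossier `bsd-wall-census/BLOCK-A-R1POTSS3-DOSSIER-v1.md` §1, §6.
-/

-- single-conjunct summit: `Summit.BirchSwinnertonDyer.BirchSwinnertonDyer.…` repeats the name by design
set_option linter.dupNamespace false
set_option autoImplicit false

noncomputable section

open scoped Classical

namespace Summit.BirchSwinnertonDyer.BirchSwinnertonDyer.Theorems.PSIrrSurjThree

open WeierstrassCurve Literature.NumberTheory.EllipticCurves Literature.NumberTheory.EllipticCurves.Rank1Residual
  Summit.BirchSwinnertonDyer.Rank1Residual.Additive Summit.BirchSwinnertonDyer.Rank1Residual.O5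

variable (W : WeierstrassCurve ℚ) [W.IsElliptic] [W.IsGloballyMinimal]

/-- **Irreducible, not onto at `3` ⟹ `Δ_min` is a `3`-adic cube.** For every globally minimal elliptic
`W/ℚ` with `E[3]` irreducible and `ρ̄_{E,3}` NOT onto: `3 ∣ v₃(Δ_min)` and `Δ_min/3^{v} ≡ ±1 (mod 9)`.
[cite: Serre1972, §2.4 Prop. 15 and §5.3] -/
theorem cubeClass_of_irr_of_not_surj (hirr : Irr W 3) (hns : ¬ Surj W 3) :
    3 ∣ padicValInt 3 W.minimalDiscriminantInt ∧
      (W.minimalDiscriminantInt / 3 ^ padicValInt 3 W.minimalDiscriminantInt % 9 = 1 ∨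
        W.minimalDiscriminantInt / 3 ^ padicValInt 3 W.minimalDiscriminantInt % 9 = 8) := by
  by_contra h
  apply hns
  refine (surj_three_iff_irr_of_not_cubeClass W ?_).mpr hirr
  by_cases h3 : 3 ∣ padicValInt 3 W.minimalDiscriminantInt
  · right
    constructor
    · intro h1; exact h ⟨h3, Or.inl h1⟩
    · intro h8; exact h ⟨h3, Or.inr h8⟩
  · exact Or.inl h3

omit [W.IsGloballyMinimal] in
/-- **Irreducible, not onto at `3` ⟹ NOT exactly one stable line at `3`** (`E[3]|G_{ℚ₃}` is IRR or SPLIT).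
[cite: Serre1972, §2.4 Prop. 15] -/
theorem numStableLinesAtThree_ne_one_of_irr_of_not_surj (hirr : Irr W 3) (hns : ¬ Surj W 3) :
    numStableLinesAtThree W ≠ 1 :=
  fun h1 ↦ hns (surj_three_of_irr_of_numStableLinesAtThree_eq_one W h1 hirr)

omit [W.IsElliptic] [W.IsGloballyMinimal] W in
/-- **W-ALL block A3 lives on the `3`-adic cube class.** The atom
`WAllExclAddPotSSAtThreeRankOneIrrNotSurj` (non-CM, `ClassO5 ∨ ClassO6` at `3`, `Irr W 3`, `¬ Surj W 3`,
`r = 1` ⇒ `BSD(E,3)`) is equivalent to its restriction to the rows where `Δ_min` is a `3`-adic cube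
(`3 ∣ v₃Δ_min ∧ Δ_min/3^v ≡ ±1 (mod 9)`): elsewhere there is no such curve (`cubeClass_of_irr_of_not_surj`).
[cite: Serre1972, §2.4 Prop. 15 and §5.3] -/
theorem wAllExclAddPotSSAtThreeRankOneIrrNotSurj_iff_cubeClass :
    WAllExclAddPotSSAtThreeRankOneIrrNotSurj ↔
      ∀ (W : WeierstrassCurve ℚ) [W.IsElliptic] [W.IsGloballyMinimal], ¬ W.HasCM →
        ClassO5 W 3 ∨ ClassO6 W 3 →
        (3 ∣ padicValInt 3 W.minimalDiscriminantInt ∧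
          (W.minimalDiscriminantInt / 3 ^ padicValInt 3 W.minimalDiscriminantInt % 9 = 1 ∨
            W.minimalDiscriminantInt / 3 ^ padicValInt 3 W.minimalDiscriminantInt % 9 = 8)) →
        Irr W 3 → ¬ Surj W 3 → W.analyticRank = 1 → BSDp W 3 :=
  ⟨fun h W _ _ hCM hO _ hirr hns hr ↦ h W hCM hO hirr hns hr,
    fun h W _ _ hCM hO hirr hns hr ↦ h W hCM hO (cubeClass_of_irr_of_not_surj W hirr hns) hirr hns hr⟩

omit [W.IsElliptic] [W.IsGloballyMinimal] W in
/-- **The tame part of block A3 lives on the cube class** (`ClassO5` at `3`: Kodaira `III`/`III*`,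
`v₃Δ_min ∈ {3, 9}`, so the condition is `Δ_min/3^v ≡ ±1 (mod 9)`): the atom
`WAllExclAddTameSSAtThreeRankOneIrrNotSurj` is equivalent to its cube-class restriction.
[cite: Serre1972, §2.4 Prop. 15 and §5.3] -/
theorem wAllExclAddTameSSAtThreeRankOneIrrNotSurj_iff_cubeClass :
    WAllExclAddTameSSAtThreeRankOneIrrNotSurj ↔
      ∀ (W : WeierstrassCurve ℚ) [W.IsElliptic] [W.IsGloballyMinimal], ¬ W.HasCM → ClassO5 W 3 →
        (3 ∣ padicValInt 3 W.minimalDiscriminantInt ∧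
          (W.minimalDiscriminantInt / 3 ^ padicValInt 3 W.minimalDiscriminantInt % 9 = 1 ∨
            W.minimalDiscriminantInt / 3 ^ padicValInt 3 W.minimalDiscriminantInt % 9 = 8)) →
        Irr W 3 → ¬ Surj W 3 → W.analyticRank = 1 → BSDp W 3 :=
  ⟨fun h W _ _ hCM hO _ hirr hns hr ↦ h W hCM hO hirr hns hr,
    fun h W _ _ hCM hO hirr hns hr ↦ h W hCM hO (cubeClass_of_irr_of_not_surj W hirr hns) hirr hns hr⟩

end Summit.BirchSwinnertonDyer.BirchSwinnertonDyer.Theorems.PSIrrSurjThree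

end
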